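import Literature.NumberTheory.Automorphic.LieAlgebraGLExponentialGenerators
import HarnessLib

/-!
# A subspace stable under `Lie(Δ)` is stabilised by a finite-index subgroup of `Δ`
(stabilisers of subspaces are algebraic; their Lie algebra; Tauvel–Yu 24.3.5 (ii) applied)

Concrete `k`-points vocabulary of the tree's linear-algebraic-groups library (`Δ ≤ GL ι k`, `IsAlgebraicSubgroup`,
`zariskiClosure`, `identityComponent`, `lieAlgebraGL`). For a subspace `U ≤ kᶥ`:

* `subspaceStabilizer U ≤ GL ι k` — the stabiliser `{g | g U ⊆ U}` (a subgroup: an injective endomorphism of the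
  finite-dimensional `U` is onto, so `g⁻¹ U ⊆ U`), `isAlgebraicSubgroup_subspaceStabilizer` (cut out by the linear equations
  `φ(g x) = 0`, `φ ∈ U⁰`, `x ∈ U`; Springer 2.3.1: isotropy groups are closed) — any field;
* over `ℂ`: `mem_lieAlgebraGL_subspaceStabilizer` — a matrix `Z` with `Z U ⊆ U` lies in `Lie(Stab U)` (its one-parameter group
  `exp(zZ)` stabilises `U`: Mathlib's `NormedSpace.exp_mem` for the closed stabiliser subalgebra, and Goodman–Wallach 1.4.10
  `Lie(G) = {Z | exp(zZ) ∈ G}` = the tree's `mem_lieAlgebraGL_of_forall_exp_smul_mem`);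
* **`exists_finiteIndex_forall_mulVec_mem_of_lieAlgebraGL_stable`** — if `U` is stable under `lieAlgebraGL Δ` then some
  finite-index subgroup `Δ' ≤ Δ` stabilises `U`: `Lie((cl Δ)°) = Lie(cl Δ) = Lie(Δ) ⊆ Lie(Stab U)`, so `(cl Δ)° ≤ Stab U` by
  Tauvel–Yu 24.3.5 (ii) (`IsZConnected.le_of_lieAlgebraGL_le`), and `Δ' = Δ ∩ (cl Δ)°` has finite index (Springer 2.2.1);
  contrapositive **`forall_lieAlgebraGL_stable_imp_of_forall_finiteIndex`**: if every finite-index subgroup of `Δ` acts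
  irreducibly on `kᶥ = ℂᶥ` (inside a fixed subspace `M`), so does `Lie(Δ)`.

Written for the Hodge cell's crux K1Q (BQ-CORE: STRONG irreducibility of the monodromy ⇒ irreducibility of the Lie algebra of
its Zariski closure, the input of Katz's theorems 1.2 ∕ 1.4). THEOREMS + two subgroup∕subalgebra definitions; no instance, no
notation, no named fact.

Sources: T. A. Springer, *Linear Algebraic Groups* (2nd ed.) 2.2.1, 2.3.1; P. Tauvel, R. W. T. Yu, *Lie Algebras and Algebraic
Groups* 24.3.5; R. Goodman, N. R. Wallach, *Symmetry, Representations, and Invariants* Thm. 1.4.10.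
-/

namespace Literature.NumberTheory.Automorphic

open NormedSpace Matrix MvPolynomial

variable {k : Type*} [Field k] {ι : Type*} [Fintype ι] [DecidableEq ι]

/-! ## The stabiliser of a subspace -/

/-- The stabiliser `{g ∈ GL ι k | g U ⊆ U}` of a subspace `U ≤ kᶥ` (then `g U = U` and `g⁻¹ U = U`, `U` being finite
dimensional). [cite: SpringerLAG1998, 2.3.1] -/
def subspaceStabilizer (U : Submodule k (ι → k)) : Subgroup (GL ι k) where
  carrier := {g | ∀ x ∈ U, (g : Matrix ι ι k) *ᵥ x ∈ U}
  one_mem' := fun x hx => by simpa using hx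
  mul_mem' := fun {g h} hg hh x hx => by
    rw [Units.val_mul, ← Matrix.mulVec_mulVec]
    exact hg _ (hh _ hx)
  inv_mem' := fun {g} hg x hx => by
    -- the restriction of `g` to `U` is injective, hence surjective
    let f : U →ₗ[k] U := (Matrix.mulVecLin (g : Matrix ι ι k)).restrict fun y hy => hg y hy
    have hfinj : Function.Injective f := by
      intro y y' hyy'
      apply Subtype.ext
      have h1 : (g : Matrix ι ι k) *ᵥ (y : ι → k) = (g : Matrix ι ι k) *ᵥ (y' : ι → k) := by
        simpa [f, LinearMap.restrict_apply] using congrArg Subtype.val hyy'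
      have h2 := congrArg (fun w => ((g⁻¹ : GL ι k) : Matrix ι ι k) *ᵥ w) h1
      simpa only [Matrix.mulVec_mulVec, ← Units.val_mul, inv_mul_cancel, Units.val_one, Matrix.one_mulVec] using h2
    obtain ⟨y, hy⟩ := (LinearMap.injective_iff_surjective.1 hfinj) ⟨x, hx⟩
    have hy' : (g : Matrix ι ι k) *ᵥ (y : ι → k) = x := by
      simpa [f, LinearMap.restrict_apply] using congrArg Subtype.val hy
    rw [← hy', Matrix.mulVec_mulVec, ← Units.val_mul, inv_mul_cancel, Units.val_one, Matrix.one_mulVec]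
    exact y.2

/-- Membership in the stabiliser. [cite: SpringerLAG1998, 2.3.1] -/
theorem mem_subspaceStabilizer_iff {U : Submodule k (ι → k)} {g : GL ι k} :
    g ∈ subspaceStabilizer U ↔ ∀ x ∈ U, (g : Matrix ι ι k) *ᵥ x ∈ U := Iff.rfl

/-- **Stabilisers of subspaces are algebraic** (Springer 2.3.1: isotropy groups are closed): `subspaceStabilizer U` is cut out
by the linear equations `φ (g x) = 0` for `φ` in the dual annihilator of `U` and `x ∈ U`. [cite: SpringerLAG1998, 2.3.1] -/
theorem isAlgebraicSubgroup_subspaceStabilizer (U : Submodule k (ι → k)) : IsAlgebraicSubgroup (subspaceStabilizer U) := by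
  classical
  -- the polynomial `g ↦ φ (g x)`
  let P : Module.Dual k (ι → k) → (ι → k) → MvPolynomial (GLCoord ι) k := fun φ x =>
    ∑ i, C (φ fun j => if i = j then 1 else 0) * ∑ l, X (Sum.inl (i, l)) * C (x l)
  have hP : ∀ φ x (g : GL ι k), eval (glCoordFun g) (P φ x) = φ ((g : Matrix ι ι k) *ᵥ x) := by
    intro φ x g
    rw [LinearMap.pi_apply_eq_sum_univ φ ((g : Matrix ι ι k) *ᵥ x)]
    simp only [P, map_sum, map_mul, eval_C, eval_X, glCoordFun_inl, smul_eq_mul]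
    refine Finset.sum_congr rfl fun i _ => ?_
    rw [mul_comm, Matrix.mulVec, dotProduct]
  refine ⟨⋃ φ ∈ U.dualAnnihilator, ⋃ x ∈ U, {P φ x}, ?_⟩
  ext g
  simp only [SetLike.mem_coe, mem_subspaceStabilizer_iff, zeroLocusGL, Set.mem_setOf_eq, Set.mem_iUnion,
    Set.mem_singleton_iff]
  constructor
  · rintro hg p ⟨φ, hφ, x, hx, rfl⟩
    rw [hP]
    exact (Submodule.mem_dualAnnihilator φ).1 hφ _ (hg x hx)
  · intro hg x hx
    rw [← Subspace.forall_mem_dualAnnihilator_apply_eq_zero_iff U]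
    intro φ hφ
    rw [← hP]
    exact hg _ ⟨φ, hφ, x, hx, rfl⟩

/-! ## Over `ℂ`: the Lie algebra of the stabiliser -/

section Complex

variable {ι : Type*} [Fintype ι] [DecidableEq ι]

/-- The stabiliser SUBALGEBRA `{A ∈ Mat_ι(ℂ) | A U ⊆ U}` of a subspace `U ≤ ℂᶥ` (as a `ℚ`-subalgebra, the shape Mathlib's
`NormedSpace.exp_mem` wants; Goodman–Wallach §1.4.4 works inside such matrix algebras). [cite: GoodmanWallachGTM255, §1.4.4 Theorem 1.4.10] [cite: SpringerLAG1998, 2.3.1] -/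
def subspaceStabilizerSubalgebra (U : Submodule ℂ (ι → ℂ)) : Subalgebra ℚ (Matrix ι ι ℂ) where
  carrier := {A | ∀ x ∈ U, A *ᵥ x ∈ U}
  mul_mem' := fun {A B} hA hB x hx => by
    rw [← Matrix.mulVec_mulVec]
    exact hA _ (hB _ hx)
  one_mem' := fun x hx => by simpa using hx
  add_mem' := fun {A B} hA hB x hx => by
    rw [Matrix.add_mulVec]
    exact U.add_mem (hA x hx) (hB x hx)
  zero_mem' := fun x _ => by simp
  algebraMap_mem' := fun q x hx => by
    rw [Algebra.algebraMap_eq_smul_one, Matrix.smul_mulVec, Matrix.one_mulVec]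
    exact U.smul_of_tower_mem q hx

/-- Membership in the stabiliser subalgebra. [cite: SpringerLAG1998, 2.3.1] -/
theorem mem_subspaceStabilizerSubalgebra_iff {U : Submodule ℂ (ι → ℂ)} {A : Matrix ι ι ℂ} :
    A ∈ subspaceStabilizerSubalgebra U ↔ ∀ x ∈ U, A *ᵥ x ∈ U := Iff.rfl

/-- The stabiliser subalgebra is closed (an intersection of preimages of the closed subspace `U` under the continuous maps
`A ↦ A x`), the closedness Goodman–Wallach 1.4.10 needs. [cite: GoodmanWallachGTM255, §1.4.4 Theorem 1.4.10] [cite: SpringerLAG1998, 2.3.1] -/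
theorem isClosed_subspaceStabilizerSubalgebra (U : Submodule ℂ (ι → ℂ)) :
    IsClosed (subspaceStabilizerSubalgebra U : Set (Matrix ι ι ℂ)) := by
  have : (subspaceStabilizerSubalgebra U : Set (Matrix ι ι ℂ)) = ⋂ x ∈ U, (fun A : Matrix ι ι ℂ => A *ᵥ x) ⁻¹' (U : Set (ι → ℂ)) := by
    ext A
    simp [mem_subspaceStabilizerSubalgebra_iff]
  rw [this]
  exact isClosed_biInter fun x _ => (U.closed_of_finiteDimensional).preimage (continuous_id.matrix_mulVec continuous_const)

/-- `exp` of a matrix stabilising `U` stabilises `U`. [cite: GoodmanWallachGTM255, §1.4.4 Theorem 1.4.10] -/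
theorem exp_mulVec_mem_of_forall_mulVec_mem {U : Submodule ℂ (ι → ℂ)} {Z : Matrix ι ι ℂ} (hZ : ∀ x ∈ U, Z *ᵥ x ∈ U)
    {x : ι → ℂ} (hx : x ∈ U) : exp Z *ᵥ x ∈ U :=
  (exp_mem (s := subspaceStabilizerSubalgebra U) (isClosed_subspaceStabilizerSubalgebra U) (show Z ∈ subspaceStabilizerSubalgebra U from hZ)) x hx

/-- **A matrix stabilising `U` lies in the Lie algebra of the stabiliser of `U`** (its one-parameter group `exp(zZ)` lies in
`Stab U`; Goodman–Wallach 1.4.10). [cite: GoodmanWallachGTM255, §1.4.4 Theorem 1.4.10] [cite: TauvelYu2005, 24.3.5] -/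
theorem mem_lieAlgebraGL_subspaceStabilizer {U : Submodule ℂ (ι → ℂ)} {Z : Matrix ι ι ℂ} (hZ : ∀ x ∈ U, Z *ᵥ x ∈ U) :
    Z ∈ lieAlgebraGL (subspaceStabilizer U) := by
  refine mem_lieAlgebraGL_of_forall_exp_smul_mem (isAlgebraicSubgroup_subspaceStabilizer U) fun z => ?_
  refine ⟨(Matrix.isUnit_exp (z • Z)).unit, ?_, (Matrix.isUnit_exp (z • Z)).unit_spec⟩
  rw [mem_subspaceStabilizer_iff]
  intro x hx
  rw [(Matrix.isUnit_exp (z • Z)).unit_spec]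
  exact exp_mulVec_mem_of_forall_mulVec_mem (fun y hy => by rw [Matrix.smul_mulVec]; exact U.smul_mem z (hZ y hy)) hx

/-- **A subspace stable under `Lie(Δ)` is stabilised by a finite-index subgroup of `Δ`.** For `Δ ≤ GL ι ℂ` and `U ≤ ℂᶥ` with
`Z U ⊆ U` for all `Z ∈ lieAlgebraGL Δ`: there is `Δ' ≤ Δ` of finite index with `g U ⊆ U` for all `g ∈ Δ'` (namely
`Δ ∩ (cl Δ)°`: `Lie((cl Δ)°) = Lie(Δ) ⊆ Lie(Stab U)` forces `(cl Δ)° ≤ Stab U`, Tauvel–Yu 24.3.5 (ii); `(cl Δ)°` has finite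
index in `cl Δ ⊇ Δ`, Springer 2.2.1). [cite: TauvelYu2005, 24.3.5 (ii)] [cite: SpringerLAG1998, 2.2.1] -/
theorem exists_finiteIndex_forall_mulVec_mem_of_lieAlgebraGL_stable (Δ : Subgroup (GL ι ℂ)) (U : Submodule ℂ (ι → ℂ))
    (hU : ∀ Z ∈ lieAlgebraGL Δ, ∀ x ∈ U, Z *ᵥ x ∈ U) :
    ∃ Δ' : Subgroup (GL ι ℂ), Δ' ≤ Δ ∧ (Δ'.subgroupOf Δ).FiniteIndex ∧
      ∀ g ∈ Δ', ∀ x ∈ U, ((g : GL ι ℂ) : Matrix ι ι ℂ) *ᵥ x ∈ U := by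
  set G := zariskiClosure Δ with hGdef
  have hG : IsAlgebraicSubgroup G := isAlgebraicSubgroup_zariskiClosure Δ
  have hle : identityComponent G ≤ subspaceStabilizer U := by
    refine (isZConnected_identityComponent hG).le_of_lieAlgebraGL_le (isAlgebraicSubgroup_subspaceStabilizer U) ?_
    rw [lieAlgebraGL_identityComponent hG, hGdef, lieAlgebraGL_zariskiClosure]
    intro Z hZ
    exact mem_lieAlgebraGL_subspaceStabilizer (hU Z hZ)
  refine ⟨identityComponent G ⊓ Δ, inf_le_right, ?_, fun g hg => (mem_subspaceStabilizer_iff.1 (hle hg.1))⟩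
  -- finite index of `Δ ∩ (cl Δ)°` in `Δ`
  constructor
  change (identityComponent G ⊓ Δ).relIndex Δ ≠ 0
  rw [Subgroup.inf_relIndex_right]
  intro h0
  exact (finiteIndex_identityComponent hG).index_ne_zero
    (Subgroup.relIndex_eq_zero_of_le_right (le_zariskiClosure Δ) h0)

/-- **Contrapositive, the form the Hodge cell consumes: STRONG irreducibility passes to the Lie algebra.** If every finite-index
subgroup `Δ' ≤ Δ` leaves invariant no subspace `U` with `U ≤ M`, `U ≠ ⊥`, `U ≠ M`, then neither does `lieAlgebraGL Δ`:
every `Lie(Δ)`-stable `U ≤ M` is `⊥` or `M`. [cite: TauvelYu2005, 24.3.5 (ii)] [cite: SpringerLAG1998, 2.2.1] -/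
theorem eq_bot_or_eq_of_lieAlgebraGL_stable_of_forall_finiteIndex (Δ : Subgroup (GL ι ℂ)) (M : Submodule ℂ (ι → ℂ))
    (hirr : ∀ Δ' : Subgroup (GL ι ℂ), Δ' ≤ Δ → (Δ'.subgroupOf Δ).FiniteIndex →
      ∀ U : Submodule ℂ (ι → ℂ), U ≤ M → (∀ g ∈ Δ', ∀ x ∈ U, ((g : GL ι ℂ) : Matrix ι ι ℂ) *ᵥ x ∈ U) → U = ⊥ ∨ U = M)
    {U : Submodule ℂ (ι → ℂ)} (hUM : U ≤ M) (hU : ∀ Z ∈ lieAlgebraGL Δ, ∀ x ∈ U, Z *ᵥ x ∈ U) : U = ⊥ ∨ U = M := by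
  obtain ⟨Δ', hle, hfi, hstab⟩ := exists_finiteIndex_forall_mulVec_mem_of_lieAlgebraGL_stable Δ U hU
  exact hirr Δ' hle hfi U hUM hstab

end Complex

end Literature.NumberTheory.Automorphic
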